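import Mathlib
import HarnessLib
import Summits.HubbardSuperconductivity.HubbardSuperconductivity.Theorems.KLProgrammeH10TwoPointLimitPerturbedCountPairsThinExists
import Summits.HubbardSuperconductivity.HubbardSuperconductivity.Theorems.KLProgrammeH10TwoPointLimitPerturbedCountThinSmallnessExplicit

/-!
# Route `KLProgramme` — the THIN anchored pair count on the perturbed curve with the EXPLICIT perturbation size `κ = pcThinKappa B m`,
# parametric in the bundle `B : BandBounds a b` (cure (γ) of located #15 «(X).1-C-DOOR-SLOT», step 2a)

Cell gate-hubbard-kl, seat p3 g25.  `countPairs_thin_perturbed` (p4, `…PerturbedCountPairsThinExists`) produces its perturbation size from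
`exists_thin_small_constants` (continuity at `0`, opaque) at the generic bundle `bandBounds ha hab hb`.  The same proof with
`exists_thin_small_constants_explicit` (`…PerturbedCountThinSmallnessExplicit`) gives the count for ANY bundle `B : BandBounds a b` at the CLOSED-FORM size
`κ = pcThinKappa B m` (`KLProgrammePerturbedCountThinConstantsDefs`); the grid threshold `w₁` and the constant `K_p` stay existential (they are never doors).

* **`countPairs_thin_perturbed_explicit`** — `∃ κ, κ = pcThinKappa B m ∧ 0 < κ ∧ ∃ m₀ w₁ K_p, …` (the conclusion of `countPairs_thin_perturbed` verbatim after `κ`).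
Next (step 2b–2d): `anchoredSectorCount_thin_perturbed/_frame/_frameOK` and `card_bgmSectorSet_klAniso_anchored_le_linear` with the explicit `κ`, then `klThinCountC₃′`.
Everything is PROVED; no definitions; nothing about the Hubbard model is asserted.  References: BGM 2006 Lemma 3.1 / (2.80) / App. A2–A3
[cite: BenfattoGiulianiMastropietro2006]; Mastropietro 2008 (14.67) [cite: Mastropietro2008].
-/

noncomputable section

namespace Summit.HubbardSuperconductivity.HubbardSuperconductivity.Theorems.PerturbedFermiCurve

set_option linter.dupNamespace false -- summit = problem name (single-conjunct summit), D-0017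

open Classical
open Real Set
open Literature.MathematicalPhysics.QuantumLattice Literature.MathematicalPhysics.QuantumLattice.BandSectorCounting

/-- **The thin anchored pair count on the perturbed Fermi curve at the EXPLICIT perturbation size `pcThinKappa B m`, any bundle `B`.**
[cite: BenfattoGiulianiMastropietro2006, Lemma 3.1 / (2.80) / App. A2–A3] -/
theorem countPairs_thin_perturbed_explicit {a b : ℝ} (B : BandBounds a b) (Cr m : ℝ) (hCr : 0 < Cr) (hm : 0 < m) :
    ∃ κ : ℝ, κ = pcThinKappa B m ∧ 0 < κ ∧ ∃ m₀ : ℝ, 0 < m₀ ∧ m₀ ≤ m ∧ κ ≤ m₀ ∧ ∃ w₁ : ℝ, 0 < w₁ ∧ ∃ Kp : ℝ, 0 < Kp ∧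
        ∀ δ : (Fin 2 → ℝ) → ℝ, ContDiff ℝ 2 δ → (∀ k, δ (-k) = δ k) →
          (∀ k : Fin 2 → ℝ, |δ k| ≤ κ) → (∀ k : Fin 2 → ℝ, ‖fderiv ℝ δ k‖ ≤ κ) → (∀ k : Fin 2 → ℝ, ‖fderiv ℝ (fderiv ℝ δ) k‖ ≤ κ) →
        ∀ μ : ℝ, a ≤ μ - κ - m₀ → μ + κ + m₀ ≤ b →
        ∀ u : ℝ → ℝ, (∀ θ, IsBandFermiRadius (μ - δ (u θ • dir θ)) θ (u θ)) →
        ∀ (θ₁ w : ℝ) (N Nh : ℕ), 0 < w → w ≤ w₁ → (N : ℝ) * w = 2 * π → (Nh : ℝ) * w = π → N = 2 * Nh →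
          ((((Finset.range N ×ˢ Finset.range N).filter fun p : ℕ × ℕ =>
            ∃ θ₁' x' y' : ℝ, |θ₁ - θ₁'| ≤ w ∧ |w / 2 + p.1 * w - x'| ≤ w ∧ |w / 2 + p.2 * w - y'| ≤ w ∧
              |hfunE δ u μ (XE u θ₁', YE u θ₁') x' y'| ≤ Cr * w ^ 2).card : ℝ)) ≤ Kp / w := by
  obtain ⟨κ, τ, lam, f, e, s, hκeq, hκ0, hκD, hκs, hs0, hsm, hτ0, hτπ, hlam0, hf0, he0, hfs, hes, hes2,
    c1, c2, c3, c4, c5, c6, c7, c8, c9, c10, c11, c12, c13, c14, c16, c17, c18, c19, c20⟩ := exists_thin_small_constants_explicit B hm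
  obtain ⟨Kp, hKp, hcount⟩ := count_pairs_thin_perturbed_exists B (κ₀ := κ) (κ₁ := κ) (κ₂ := κ) (Cr := Cr) (τ := τ) (lam := lam) (η₀F := f)
    (η₀K := 2 * e) (η₀'' := e) (η₁'' := e) (η₀S := s) (η₁S := s) (R := 2 * e / B.hmin) (m₀ := s)
    hκ0.le hκD hκ0.le hCr hτ0 hτπ hlam0 hf0 hfs le_rfl hes hes2 c1 c2 c3 c4 hs0 hs0 c5 he0 (by have := B.hmin_pos; positivity)
    c6 c7 c8 c9 c10 c11 c12 c13 c14 le_rfl c16 c17 c18 c19 c20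
  -- the grid threshold
  set Kfat := Cr + 3 * ((4 + κ) * pcSE B κ) with hKfat
  set K₁ := 5 * ((4 + κ) * pcSE B κ ^ 2) + 3 * ((4 + κ) * pcAE B κ κ) with hK₁
  set K₂ := 8 * ((4 + κ) * pcSE B κ ^ 2) + 2 * ((4 + κ) * pcAE B κ κ) with hK₂
  set K₃ := 3 * ((4 + κ) * pcSE B κ ^ 2) + 2 * ((4 + κ) * pcAE B κ κ) with hK₃
  set Ccoop := (Cr + 2 * Cr / 1 + 2 * K₁ + K₂) + K₁ * τ with hCcoop
  set Cfold := (Cr + 8 * K₃) + 2 * K₃ * π + K₃ * τ with hCfold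
  obtain ⟨-, hSE, -, -, hAE, -⟩ := pc_pos B hκ0.le hκD hκ0.le
  have hKfat0 : 0 < Kfat := by rw [hKfat]; positivity
  have hCcoop0 : 0 < Ccoop := by rw [hCcoop, hK₁, hK₂]; positivity
  have hCfold0 : 0 < Cfold := by rw [hCfold, hK₃]; positivity
  set w₁ := min 1 (min (f / 2 / Kfat) (min (f / 2 / Ccoop) (f / 2 / Cfold))) with hw₁
  have hw₁0 : 0 < w₁ := lt_min one_pos (lt_min (by positivity) (lt_min (by positivity) (by positivity)))
  refine ⟨κ, hκeq, hκ0, s, hs0, hsm, hκs, w₁, hw₁0, Kp, hKp, ?_⟩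
  intro δ hδs heven hδ hκ hκ₂ μ hlo hhi u hu θ₁ w N Nh hw hww hN hNh hNN
  have hw1 : w ≤ 1 := hww.trans (min_le_left _ _)
  have hwf : w ≤ f / 2 / Kfat := hww.trans ((min_le_right _ _).trans (min_le_left _ _))
  have hwc : w ≤ f / 2 / Ccoop := hww.trans ((min_le_right _ _).trans ((min_le_right _ _).trans (min_le_left _ _)))
  have hwd : w ≤ f / 2 / Cfold := hww.trans ((min_le_right _ _).trans ((min_le_right _ _).trans (min_le_right _ _)))
  have e1 : Kfat * w ≤ f / 2 := by rw [le_div_iff₀ hKfat0] at hwf; linarith only [hwf]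
  have e2 : Ccoop * w ≤ f / 2 := by rw [le_div_iff₀ hCcoop0] at hwc; linarith only [hwc]
  have e3 : Cfold * w ≤ f / 2 := by rw [le_div_iff₀ hCfold0] at hwd; linarith only [hwd]
  exact hcount δ hδs heven hδ hκ hκ₂ μ hlo hhi u hu θ₁ w N Nh hw hw1 hN hNh hNN e1 e2 e3

end Summit.HubbardSuperconductivity.HubbardSuperconductivity.Theorems.PerturbedFermiCurve

end
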